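import Mathlib
import HarnessLib
import Summits.HubbardSuperconductivity.HubbardSuperconductivity.Theorems.KLProgrammeKLRegimeEngineTowerLipschitz
import Summits.HubbardSuperconductivity.HubbardSuperconductivity.Theorems.KLProgrammeKLRegimeEngineTowerReadout

/-!
# Route `KLProgramme` — crux K3 ENGINE (stmt-HubbardSuperconductivity-20437 `KLRegimeEngineV17F2`), stub (e) rows C1/C2 «(e)-C ⇐ (b)-TWOVOL»:
# the READ-OUT of the LIPSCHITZ (two-volume / two-cutoff difference) tower at an arbitrary level
# (cell gate-hubbard-kl, seat hubbard-kl-k3c5-p2 g9; the polarised twin of E1's part 7 `…EngineTowerReadout`, p-numbering «part 7-Lip»)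

E1's part 11 (`towerBornDiff_le_law₄`, T3-Lip₄) closes the DIFFERENCE tower at the block boundaries `J_k`: the born differences obey the RELATIVE law
`db k p ≤ R k · Aλ^{p−1}Q^p` (`3 ≤ p ≤ D`) with an additive budget `R`.  Rows C1/C2 of stub (e) (`TwoLegVolumeRateF … n′` for EVERY `n′ ≤ n`) and
the two-cutoff twin read the two volumes' difference at EVERY level `j`, not only at the boundaries — exactly as the public one-volume laws are read at
every level by part 7 (`towerReadout_le`): with `J_k ≤ j < J_{k+1}`, `𝒱_j − 𝒱′_j = (𝒱_{J_k} − 𝒱′_{J_k}) + [(𝒱_j − 𝒱_{J_k}) − (𝒱′_j − 𝒱′_{J_k})]`, so the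
difference's size at `j` is at most (measured size of the boundary difference at family `j`) + (born DIFFERENCE of the ONE partial-block increment
`J_k → j`).  Nothing is fed back, so no blocking condition is needed and the partial block's constants go into the public constant:

* `towerReadoutDiffMeasured_le` — the measured DIFFERENCE profile at a read-out level from the relative born law (jump ≥ 0 blocks, linear
  re-measurement, `towerReadoutMeasured_le` on `db` with the monotone budget): `dμ m ≤ R k·(c₁A/(1−g))·λ^{m−1}·(c₂Q)^m` for `4 ≤ m ≤ D`;
* **`towerReadoutDiffIncrement_le`** — the partial-block DIFFERENCE increment in every degree `2p ≥ 6` from the four-piece Chernoff data of the COMMON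
  majorant `μ` (`ι₁λ, ι₂λ, ι₃λ², A″λ^{m−1}Q″^m`) and the RELATIVE four-piece data of the difference `dμ` (`r·ι₁λ, r·ι₂λ, r·ι₃λ², r·A″λ^{m−1}Q″^m`,
  `r` = the budget `R k`), the LIPSCHITZ step hypothesis of `towerLipStep_le_of_chernoff` (first order linear in `dμ`, telescoped graded orders `towerSLip`,
  `Ct` tails of the majorant, a source `src`):
  `dinc ≤ r·λ^{p−1}·(A″(4Q″)^p·x₁/(1−x₁) + e·ψ·(2τψQ″)^{p−1}·τY·(2y − y²)/(1 − y)²) + src`, `Y = ι₁λ + ι₂/(2Q″) + ι₃/(4Q″²) + A″Q″/4`, `y = ΦτY`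
  — `r ×` part 7's increment law with `y/(1−y) ↦ (2y−y²)/(1−y)²`, plus the step's own volume/cutoff source;
* **`towerReadoutDiff_le`** — assembled: `dpub ≤ dμ p + dinc` ⇒ `dpub ≤ r·λ^{p−1}·(M_p + A″(4Q″)^p·x₁/(1−x₁) + e·ψ·(2τψQ″)^{p−1}·τY·(2y−y²)/(1−y)²) + src`,
  `M_p = A″Q″^p` (`p ≥ 4`) or `M_3 = ι₃`.
The low output degrees at a read-out level (`p = 1`: the two-leg rows C1/C2 themselves; `p = 2`) are part 11b's `towerTwoLegDiffIncrement_le` /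
`towerQuarticDiffIncrement_le` VERBATIM with the read-out profile of the first bullet (nothing there is boundary-specific).  Pure real analysis; nothing
about the model is asserted.  NOT here: the Grassmann suppliers (G1-Lip p563516/p570591, Hstep-Lip doors p572336/p573833), the index-set glue (p562385),
the transfer map and the sources (k3c4-p1), the dual read-out rows (p551351).  References: Benfatto–Giuliani–Mastropietro 2006 §2.8 (2.83), Lemma 2.5;
Gawȩdzki–Kupiainen 1985 §3.
-/

noncomputable section

namespace Summit.HubbardSuperconductivity.HubbardSuperconductivity.Theorems.EngineV8

set_option linter.dupNamespace false -- summit = problem name (single-conjunct summit), D-0017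

open Real Finset

/-- **The measured DIFFERENCE profile at a read-out level from the relative born law** (degrees `2m ≥ 8`): if the born differences at the
boundaries `k' ≤ k` obey `db k' m ≤ R k'·(Aλ^{m−1}Q^m)` (`3 ≤ m ≤ D`, part 11's conclusion) with a budget monotone up to `k`, and the difference of the
two volumes' `𝒱_{J_k}` measured at the read-out family is bounded by the jump-`≥ 0` re-measurement sum `dμ m ≤ Σ_{k'≤k} c₁c₂^m g^{(m−2)(k−k')} db k' m`
(`4 ≤ m ≤ D`; re-measurement is linear), then `dμ m ≤ R k·(c₁A/(1−g))·λ^{m−1}·(c₂Q)^m` there. -/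
theorem towerReadoutDiffMeasured_le {D : ℕ} {db dμ : ℕ → ℕ → ℝ} {R : ℕ → ℝ} {A lam Q g c₁ c₂ : ℝ}
    (hA : 0 ≤ A) (hlam : 0 ≤ lam) (hQ : 0 ≤ Q) (hg0 : 0 ≤ g) (hg1 : g < 1) (hc₁ : 0 ≤ c₁) (hc₂ : 0 ≤ c₂)
    (hdb0 : ∀ k m, 0 ≤ db k m) {k : ℕ} (hRk : 0 ≤ R k) (hRmono : ∀ k' ≤ k, R k' ≤ R k)
    (hdμ : ∀ m, 4 ≤ m → m ≤ D → dμ k m ≤ ∑ k' ∈ range (k + 1), c₁ * c₂ ^ m * g ^ ((m - 2) * (k - k')) * db k' m)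
    (hborn : ∀ k' ≤ k, ∀ m, 3 ≤ m → m ≤ D → db k' m ≤ R k' * (A * lam ^ (m - 1) * Q ^ m))
    {m : ℕ} (hm : 4 ≤ m) (hmD : m ≤ D) :
    dμ k m ≤ R k * (c₁ * A / (1 - g)) * lam ^ (m - 1) * (c₂ * Q) ^ m := by
  -- born differences at boundaries `k' ≤ k` are below the law with the CURRENT budget `R k`
  have hborn' : ∀ k' ≤ k, ∀ m, 3 ≤ m → m ≤ D → db k' m ≤ (R k * A) * lam ^ (m - 1) * Q ^ m := by
    intro k' hk' m hm3 hmD'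
    calc db k' m ≤ R k' * (A * lam ^ (m - 1) * Q ^ m) := hborn k' hk' m hm3 hmD'
      _ ≤ R k * (A * lam ^ (m - 1) * Q ^ m) := mul_le_mul_of_nonneg_right (hRmono k' hk') (by positivity)
      _ = (R k * A) * lam ^ (m - 1) * Q ^ m := by ring
  have h := towerReadoutMeasured_le (D := D) (μ := dμ) (mul_nonneg hRk hA) hlam hQ hg0 hg1 hc₁ hc₂ hdb0 hdμ hborn' hm hmD
  calc dμ k m ≤ c₁ * (R k * A) / (1 - g) * lam ^ (m - 1) * (c₂ * Q) ^ m := h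
    _ = R k * (c₁ * A / (1 - g)) * lam ^ (m - 1) * (c₂ * Q) ^ m := by ring

/-- **The partial-block DIFFERENCE increment at a read-out level, every degree `2p ≥ 6`** (the polarised twin of `towerReadoutIncrement_le`).  Inputs
= the sizes at the read-out family of the two volumes' `𝒱_{J_k}`: the COMMON majorant `0 ≤ μ` with imports `μ 1 ≤ ι₁λ`, `μ 2 ≤ ι₂λ`, six legs
`μ 3 ≤ ι₃λ²` and the profile `μ m ≤ A″λ^{m−1}Q″^m` (`4 ≤ m ≤ D`), and the DIFFERENCE `0 ≤ dμ` with the RELATIVE data `dμ 1 ≤ r·ι₁λ`, `dμ 2 ≤ r·ι₂λ`,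
`dμ 3 ≤ r·ι₃λ²`, `dμ m ≤ r·A″λ^{m−1}Q″^m` (`r ≥ 0` the budget `R k`: `towerReadoutDiffMeasured_le` and the difference's own import rows); the suppliers'
LIPSCHITZ step hypothesis for the partial block's increment difference with the partial block's constants `(σ, Φ, ψ, τ)`, tail constant `Ct ≥ 0` and source
`src`; smallness `x₁ = 4σλQ″ < 1`, `2λτQ″ ≤ 1`, `x₃ = eτλQ″ < 1`, `y = Φτ(ι₁λ + ι₂/(2Q″) + ι₃/(4Q″²) + A″Q″/4) < 1`, `θ̄ < 1` (four-piece `V̄` of the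
majorant).  Then for `3 ≤ p`:
`dinc ≤ r·λ^{p−1}·(A″(4Q″)^p·x₁/(1−x₁) + e·ψ·(2τψQ″)^{p−1}·τ(ι₁λ + ι₂/(2Q″) + ι₃/(4Q″²) + A″Q″/4)·(2y−y²)/(1−y)²) + src` — `r ×` the one-volume
increment law of part 7 with `y/(1−y) ↦ (2y−y²)/(1−y)²`, plus the source; no blocking condition (nothing is fed back). -/
theorem towerReadoutDiffIncrement_le {D : ℕ} {μ dμ : ℕ → ℝ} {dinc σ Φ ψ τ lam A'' Q'' ι₁ ι₂ ι₃ r Ct src : ℝ}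
    (hσ : 0 ≤ σ) (hΦ : 0 ≤ Φ) (hψ : 0 ≤ ψ) (hτ : 0 < τ) (hlam : 0 < lam) (hA'' : 0 ≤ A'') (hQ'' : 0 < Q'') (hr : 0 ≤ r) (hCt : 0 ≤ Ct)
    (hμ0 : ∀ m, 0 ≤ μ m) (hι₁ : μ 1 ≤ ι₁ * lam) (hι₂ : μ 2 ≤ ι₂ * lam) (hι₃ : μ 3 ≤ ι₃ * lam ^ 2)
    (hprof : ∀ m, 4 ≤ m → m ≤ D → μ m ≤ A'' * lam ^ (m - 1) * Q'' ^ m)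
    (hdμ0 : ∀ m, 0 ≤ dμ m) (hdι₁ : dμ 1 ≤ r * ι₁ * lam) (hdι₂ : dμ 2 ≤ r * ι₂ * lam) (hdι₃ : dμ 3 ≤ r * ι₃ * lam ^ 2)
    (hdprof : ∀ m, 4 ≤ m → m ≤ D → dμ m ≤ r * A'' * lam ^ (m - 1) * Q'' ^ m)
    (hx₁ : 4 * σ * lam * Q'' < 1) (hx₂ : 2 * lam * τ * Q'' ≤ 1) (hx₃ : exp 1 * τ * lam * Q'' < 1)
    (hy : Φ * (τ * (ι₁ * lam + ι₂ / (2 * Q'') + ι₃ / (4 * Q'' ^ 2) + A'' * Q'' / 4)) < 1)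
    (hθ : Φ * (exp 1 * τ * (ι₁ * lam) + (exp 1 * τ) ^ 2 * (ι₂ * lam) + (exp 1 * τ) ^ 3 * (ι₃ * lam ^ 2) +
      A'' * (exp 1 * τ * Q'') * ((exp 1 * τ * lam * Q'') ^ 3 / (1 - exp 1 * τ * lam * Q''))) < 1)
    {p : ℕ} (hp : 3 ≤ p)
    (hstep : ∀ N : ℕ, 2 ≤ N → Φ * towerV D τ μ < 1 →
      dinc ≤ towerFO D σ dμ p + ∑ n ∈ Icc 2 N, exp 1 * Φ ^ (n - 1) * ψ ^ p * towerSLip D τ dμ μ n p +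
        Ct * (ψ ^ p * exp 1 * towerV D τ μ * (Φ * towerV D τ μ) ^ N / (1 - Φ * towerV D τ μ)) + src) :
    dinc ≤ r * (lam ^ (p - 1) * (A'' * (4 * Q'') ^ p * (4 * σ * lam * Q'' / (1 - 4 * σ * lam * Q'')) +
      exp 1 * ψ * (2 * τ * ψ * Q'') ^ (p - 1) * (τ * (ι₁ * lam + ι₂ / (2 * Q'') + ι₃ / (4 * Q'' ^ 2) + A'' * Q'' / 4)) *
        ((2 * (Φ * (τ * (ι₁ * lam + ι₂ / (2 * Q'') + ι₃ / (4 * Q'' ^ 2) + A'' * Q'' / 4))) -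
            (Φ * (τ * (ι₁ * lam + ι₂ / (2 * Q'') + ι₃ / (4 * Q'' ^ 2) + A'' * Q'' / 4))) ^ 2) /
          (1 - Φ * (τ * (ι₁ * lam + ι₂ / (2 * Q'') + ι₃ / (4 * Q'' ^ 2) + A'' * Q'' / 4))) ^ 2))) + src := by
  have hw : 1 ≤ (2 * τ * Q'' * lam)⁻¹ := (one_le_inv₀ (by positivity)).2 (by linarith)
  set Y := ι₁ * lam + ι₂ / (2 * Q'') + ι₃ / (4 * Q'' ^ 2) + A'' * Q'' / 4 with hY
  -- Chernoff data of the difference (RELATIVE four-piece profile) and of the majorant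
  have hGν := sum_fourPiece_le (D := D) (ι₁ := r * ι₁) (ι₂ := r * ι₂) (ι₃ := r * ι₃) (A' := r * A'') hτ hlam hQ''
    (mul_nonneg hr hA'') hdμ0 hdι₁ hdι₂ hdι₃ hdprof
  have hGνeq : τ * (r * ι₁ * lam + r * ι₂ / (2 * Q'') + r * ι₃ / (4 * Q'' ^ 2) + r * A'' * Q'' / 4) = r * (τ * Y) := by
    rw [hY]; ring
  rw [hGνeq] at hGν
  have hG := sum_fourPiece_le (D := D) hτ hlam hQ'' hA'' hμ0 hι₁ hι₂ hι₃ hprof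
  have hVb := towerV_le_fourPiece hτ.le hlam.le hQ''.le hA'' hμ0 hι₁ hι₂ hι₃ hprof hx₃
  have hFO := towerFO_le_of_four_le hσ (mul_nonneg hr hA'') hlam.le hQ''.le hdμ0 hdprof hx₁ hp (D := D)
  have hT2 := towerLipStep_le_of_chernoff (D := D) hΦ hψ hτ.le hdμ0 hμ0 hw hCt hFO hGν hG hVb hy hθ hstep
  refine hT2.trans (le_of_eq ?_)
  have hinv : (((2 * τ * Q'' * lam)⁻¹) ^ (p - 1))⁻¹ = (2 * τ * Q'' * lam) ^ (p - 1) := by rw [inv_pow, inv_inv]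
  rw [hinv]
  obtain ⟨q, rfl⟩ : ∃ q, p = q + 1 := ⟨p - 1, by omega⟩
  simp only [Nat.add_sub_cancel, pow_succ, mul_pow]
  ring

/-- **The read-out of the difference, assembled**: at a level whose last boundary is `k`, with the degree-`2p` size of `𝒱_j − 𝒱′_j` dominated by
(measured size of the boundary difference) + (partial-block difference increment), `3 ≤ p ≤ D`, the `4 ≤ p` case through `towerReadoutDiffMeasured_le`
and the six-leg case through the relative import `r·ι₃λ²`:
`dpub ≤ r·λ^{p−1}·(M_p + A″(4Q″)^p·x₁/(1−x₁) + e·ψ·(2τψQ″)^{p−1}·τY·(2y−y²)/(1−y)²) + src` with `M_p = A″Q″^p` (`p ≥ 4`) or `M_3 = ι₃` — the budget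
`r = R k` of part 11 times part 7's public geometric profile (with `y/(1−y) ↦ (2y−y²)/(1−y)²`), plus the read-out step's own two-volume source: a `1/L`
RATE at every level once `R k` and `src` are. -/
theorem towerReadoutDiff_le {D : ℕ} {μ dμ : ℕ → ℝ} {dpub dinc σ Φ ψ τ lam A'' Q'' ι₁ ι₂ ι₃ r Ct src : ℝ}
    (hσ : 0 ≤ σ) (hΦ : 0 ≤ Φ) (hψ : 0 ≤ ψ) (hτ : 0 < τ) (hlam : 0 < lam) (hA'' : 0 ≤ A'') (hQ'' : 0 < Q'') (hr : 0 ≤ r) (hCt : 0 ≤ Ct)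
    (hμ0 : ∀ m, 0 ≤ μ m) (hι₁ : μ 1 ≤ ι₁ * lam) (hι₂ : μ 2 ≤ ι₂ * lam) (hι₃ : μ 3 ≤ ι₃ * lam ^ 2)
    (hprof : ∀ m, 4 ≤ m → m ≤ D → μ m ≤ A'' * lam ^ (m - 1) * Q'' ^ m)
    (hdμ0 : ∀ m, 0 ≤ dμ m) (hdι₁ : dμ 1 ≤ r * ι₁ * lam) (hdι₂ : dμ 2 ≤ r * ι₂ * lam) (hdι₃ : dμ 3 ≤ r * ι₃ * lam ^ 2)
    (hdprof : ∀ m, 4 ≤ m → m ≤ D → dμ m ≤ r * A'' * lam ^ (m - 1) * Q'' ^ m)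
    (hx₁ : 4 * σ * lam * Q'' < 1) (hx₂ : 2 * lam * τ * Q'' ≤ 1) (hx₃ : exp 1 * τ * lam * Q'' < 1)
    (hy : Φ * (τ * (ι₁ * lam + ι₂ / (2 * Q'') + ι₃ / (4 * Q'' ^ 2) + A'' * Q'' / 4)) < 1)
    (hθ : Φ * (exp 1 * τ * (ι₁ * lam) + (exp 1 * τ) ^ 2 * (ι₂ * lam) + (exp 1 * τ) ^ 3 * (ι₃ * lam ^ 2) +
      A'' * (exp 1 * τ * Q'') * ((exp 1 * τ * lam * Q'') ^ 3 / (1 - exp 1 * τ * lam * Q''))) < 1)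
    {p : ℕ} (hp : 3 ≤ p) (hpD : p ≤ D) (hpub : dpub ≤ dμ p + dinc)
    (hstep : ∀ N : ℕ, 2 ≤ N → Φ * towerV D τ μ < 1 →
      dinc ≤ towerFO D σ dμ p + ∑ n ∈ Icc 2 N, exp 1 * Φ ^ (n - 1) * ψ ^ p * towerSLip D τ dμ μ n p +
        Ct * (ψ ^ p * exp 1 * towerV D τ μ * (Φ * towerV D τ μ) ^ N / (1 - Φ * towerV D τ μ)) + src) :
    dpub ≤ r * (lam ^ (p - 1) * ((if p = 3 then ι₃ else A'' * Q'' ^ p) +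
      A'' * (4 * Q'') ^ p * (4 * σ * lam * Q'' / (1 - 4 * σ * lam * Q'')) +
      exp 1 * ψ * (2 * τ * ψ * Q'') ^ (p - 1) * (τ * (ι₁ * lam + ι₂ / (2 * Q'') + ι₃ / (4 * Q'' ^ 2) + A'' * Q'' / 4)) *
        ((2 * (Φ * (τ * (ι₁ * lam + ι₂ / (2 * Q'') + ι₃ / (4 * Q'' ^ 2) + A'' * Q'' / 4))) -
            (Φ * (τ * (ι₁ * lam + ι₂ / (2 * Q'') + ι₃ / (4 * Q'' ^ 2) + A'' * Q'' / 4))) ^ 2) /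
          (1 - Φ * (τ * (ι₁ * lam + ι₂ / (2 * Q'') + ι₃ / (4 * Q'' ^ 2) + A'' * Q'' / 4))) ^ 2))) + src := by
  have hinc := towerReadoutDiffIncrement_le (D := D) hσ hΦ hψ hτ hlam hA'' hQ'' hr hCt hμ0 hι₁ hι₂ hι₃ hprof hdμ0 hdι₁ hdι₂ hdι₃ hdprof
    hx₁ hx₂ hx₃ hy hθ hp hstep
  have hdμp : dμ p ≤ r * (lam ^ (p - 1) * (if p = 3 then ι₃ else A'' * Q'' ^ p)) := by
    split_ifs with h3
    · subst h3
      calc dμ 3 ≤ r * ι₃ * lam ^ 2 := hdι₃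
        _ = r * (lam ^ (3 - 1) * ι₃) := by norm_num; ring
    · have h4 : 4 ≤ p := by omega
      calc dμ p ≤ r * A'' * lam ^ (p - 1) * Q'' ^ p := hdprof p h4 hpD
        _ = r * (lam ^ (p - 1) * (A'' * Q'' ^ p)) := by ring
  refine hpub.trans ((add_le_add hdμp hinc).trans (le_of_eq ?_))
  ring

end Summit.HubbardSuperconductivity.HubbardSuperconductivity.Theorems.EngineV8

end
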